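import Literature.MathematicalPhysics.QuantumLattice.SymmetricRegimeFunctionals
import Literature.MathematicalPhysics.QuantumLattice.PairCorrelationsProofs
import HarnessLib

/-!
# The bottom of the Rayleigh quotient of a complex matrix (`dotProduct` language)

Elementary finite-dimensional facts about the real Rayleigh quotient
`reRayleigh A v = Re (star v ⬝ᵥ (A *ᵥ v))` of a square complex matrix `A : Matrix m m ℂ`
(`SymmetricRegimeFunctionals.lean`) and its bottom `-(-A).supRayleigh` on the `dotProduct`-unit set
`{v | star v ⬝ᵥ v = 1}` (`Matrix.supRayleigh`, `PairCorrelations.lean`), as consumed by the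
open-condition form of `CooperDominance` (crux `CapRgSymmetricCertificatePinned` of
`HubbardSuperconductivity`, line `strict-continuum-certificate-transfer`):

* bookkeeping: `star v ⬝ᵥ v = Σ ‖vᵢ‖²`, scaling `q(c v) = ‖c‖² q(v)`, bilinear expansions of
  `q(α f + β g)`, normalisation of a nonzero vector, `⟨u, A v⟩ = ⟨Aᴴ u, v⟩`;
* the entry bound `|q(v)| ≤ Σᵢⱼ ‖A i j‖` on unit vectors (both signs of
  `Matrix.re_star_dotProduct_mulVec_le_sum_norm` of `PairCorrelationsProofs.lean`, so all the `⨅`/`⨆`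
  over unit vectors are over bounded ranges), compactness of the unit set, continuity of `q`;
* **attainment of the bottom** (`exists_min_reRayleigh`) and its identification with
  `-(-A).supRayleigh` (`reRayleigh_eq_of_min`, `neg_supRayleigh_neg_le`, the homogeneous form
  `bottom_mul_le_reRayleigh`);
* the **first variation** at a global minimiser `f` (`cross_eq_zero_of_min`: for `g ⊥ f`,
  `⟨f, A g⟩ + conj ⟨g, A f⟩ = 0`, i.e. `f` is an eigenvector of the Hermitian part), proved by the
  real-line perturbations `f + t g`, `f + t (I g)` without the spectral theorem;
* the **two-dimensional step** of Courant–Fischer (`exists_unit_orth_le`): every hyperplane meets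
  the plane of `f` and a unit `g ⊥ f` in a unit vector with quotient `≤ q(g)`.

No definitions.  Everything is folklore linear algebra (Courant–Fischer / Rayleigh–Ritz, e.g.
Reed–Simon IV §XIII.1, Horn–Johnson §4.2); `A` is NOT assumed Hermitian (only `Re ⟨v, A v⟩`
enters).  Deliberately not here: eigenvalue enumeration, `EuclideanSpace` transport, anything about
the torus / `D₄` (that is summit-side).  Sub-namespace `RayleighBottom` (several sibling files carry
their own `re_star_dotProduct_self`-type helpers in their own sub-namespaces).
-/

noncomputable section

namespace Literature.MathematicalPhysics.QuantumLattice

namespace RayleighBottom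

open Matrix
open scoped BigOperators ComplexConjugate ComplexOrder

section Rayleigh

variable {m : Type*} [Fintype m]

/-- `star v ⬝ᵥ v = Σ ‖vᵢ‖²` (a real number). [folklore] -/
theorem star_dotProduct_self_eq_sum (v : m → ℂ) :
    star v ⬝ᵥ v = ((∑ i, ‖v i‖ ^ 2 : ℝ) : ℂ) := by
  simp only [dotProduct, Pi.star_apply, Complex.star_def, Complex.conj_mul']
  push_cast
  rfl

/-- `Re (star v ⬝ᵥ v) = Σ ‖vᵢ‖²`. [folklore] -/
theorem re_star_dotProduct_self (v : m → ℂ) : (star v ⬝ᵥ v).re = ∑ i, ‖v i‖ ^ 2 := by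
  rw [star_dotProduct_self_eq_sum, Complex.ofReal_re]

/-- `Re (star v ⬝ᵥ v) > 0` for `v ≠ 0`. [folklore] -/
theorem re_star_dotProduct_self_pos {v : m → ℂ} (hv : v ≠ 0) : 0 < (star v ⬝ᵥ v).re := by
  obtain ⟨i, hi⟩ : ∃ i, v i ≠ 0 := by
    by_contra h
    push Not at h
    exact hv (funext h)
  rw [re_star_dotProduct_self]
  exact lt_of_lt_of_le (by positivity : 0 < ‖v i‖ ^ 2)
    (Finset.single_le_sum (fun j _ => sq_nonneg ‖v j‖) (Finset.mem_univ i))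

/-- Bilinear expansion of `⟨a u, A (b v)⟩`. [folklore] -/
theorem star_smul_dotProduct_mulVec_smul (A : Matrix m m ℂ) (a b : ℂ) (u v : m → ℂ) :
    star (a • u) ⬝ᵥ (A *ᵥ (b • v)) = star a * b * (star u ⬝ᵥ (A *ᵥ v)) := by
  rw [star_smul, Matrix.mulVec_smul, smul_dotProduct, dotProduct_smul, smul_eq_mul, smul_eq_mul]
  ring

/-- Expansion of `⟨u + v, A (u + v)⟩`. [folklore] -/
theorem star_add_dotProduct_mulVec_add (A : Matrix m m ℂ) (u v : m → ℂ) :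
    star (u + v) ⬝ᵥ (A *ᵥ (u + v)) =
      star u ⬝ᵥ (A *ᵥ u) + star u ⬝ᵥ (A *ᵥ v) + star v ⬝ᵥ (A *ᵥ u) + star v ⬝ᵥ (A *ᵥ v) := by
  rw [star_add, Matrix.mulVec_add, add_dotProduct, dotProduct_add, dotProduct_add]
  ring

/-- Expansion of `⟨α f + β g, A (α f + β g)⟩`. [folklore] -/
theorem star_lincomb_dotProduct_mulVec (A : Matrix m m ℂ) (α β : ℂ) (f g : m → ℂ) :
    star (α • f + β • g) ⬝ᵥ (A *ᵥ (α • f + β • g)) =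
      star α * α * (star f ⬝ᵥ (A *ᵥ f)) + star β * β * (star g ⬝ᵥ (A *ᵥ g)) +
        (star α * β * (star f ⬝ᵥ (A *ᵥ g)) + star β * α * (star g ⬝ᵥ (A *ᵥ f))) := by
  rw [star_add_dotProduct_mulVec_add]
  simp only [star_smul_dotProduct_mulVec_smul]
  ring

/-- Expansion of `⟨α f + β g, α f + β g⟩`. [folklore] -/
theorem star_lincomb_dotProduct (α β : ℂ) (f g : m → ℂ) :
    star (α • f + β • g) ⬝ᵥ (α • f + β • g) =
      star α * α * (star f ⬝ᵥ f) + star β * β * (star g ⬝ᵥ g) +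
        (star α * β * (star f ⬝ᵥ g) + star β * α * (star g ⬝ᵥ f)) := by
  simp only [star_add, star_smul, add_dotProduct, dotProduct_add, smul_dotProduct, dotProduct_smul,
    smul_eq_mul]
  ring

/-- `Re (conj a · a · z) = ‖a‖² Re z`. [folklore] -/
theorem re_star_mul_self_mul (a z : ℂ) : (star a * a * z).re = ‖a‖ ^ 2 * z.re := by
  rw [Complex.star_def, Complex.conj_mul', ← Complex.ofReal_pow, Complex.re_ofReal_mul]

/-- Scaling of the Rayleigh quotient: `q(c v) = ‖c‖² q(v)`. [folklore] -/
theorem reRayleigh_smul (A : Matrix m m ℂ) (c : ℂ) (v : m → ℂ) :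
    reRayleigh A (c • v) = ‖c‖ ^ 2 * reRayleigh A v := by
  rw [reRayleigh, reRayleigh, star_smul_dotProduct_mulVec_smul, re_star_mul_self_mul]

/-- `q(u + v) = q(u) + q(v) + Re(⟨u, A v⟩ + ⟨v, A u⟩)`. [folklore] -/
theorem reRayleigh_add (A : Matrix m m ℂ) (u v : m → ℂ) :
    reRayleigh A (u + v) = reRayleigh A u + reRayleigh A v +
      (star u ⬝ᵥ (A *ᵥ v) + star v ⬝ᵥ (A *ᵥ u)).re := by
  simp only [reRayleigh, star_add_dotProduct_mulVec_add, Complex.add_re]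
  ring

/-- A vector of positive norm rescales to a `dotProduct`-unit vector. [folklore] -/
theorem exists_smul_unit {v : m → ℂ} (hv : 0 < (star v ⬝ᵥ v).re) :
    ∃ c : ℂ, star (c • v) ⬝ᵥ (c • v) = 1 ∧ ‖c‖ ^ 2 * (star v ⬝ᵥ v).re = 1 := by
  set r : ℝ := ∑ i, ‖v i‖ ^ 2 with hr
  have hvr : star v ⬝ᵥ v = (r : ℂ) := star_dotProduct_self_eq_sum v
  rw [hvr, Complex.ofReal_re] at hv ⊢
  refine ⟨((Real.sqrt r)⁻¹ : ℝ), ?_, ?_⟩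
  · rw [star_smul, smul_dotProduct, dotProduct_smul, smul_smul, hvr, smul_eq_mul, Complex.star_def,
      Complex.conj_ofReal, ← Complex.ofReal_mul, ← Complex.ofReal_mul, ← Complex.ofReal_one]
    congr 1
    rw [← mul_inv, Real.mul_self_sqrt hv.le, inv_mul_cancel₀ hv.ne']
  · rw [Complex.norm_real, Real.norm_eq_abs, sq_abs, inv_pow, Real.sq_sqrt hv.le, inv_mul_cancel₀ hv.ne']

/-- **Entry bound**: `|q(v)| ≤ Σᵢⱼ ‖A i j‖` on `dotProduct`-unit vectors (both signs of the tree's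
`Matrix.re_star_dotProduct_mulVec_le_sum_norm`, applied to `A` and `-A`). [folklore] -/
theorem abs_reRayleigh_le (A : Matrix m m ℂ) {v : m → ℂ} (hv : star v ⬝ᵥ v = 1) :
    |reRayleigh A v| ≤ ∑ i, ∑ j, ‖A i j‖ := by
  refine abs_le.2 ⟨?_, Matrix.re_star_dotProduct_mulVec_le_sum_norm A v hv⟩
  have h := Matrix.re_star_dotProduct_mulVec_le_sum_norm (-A) v hv
  rw [Matrix.neg_mulVec, dotProduct_neg, Complex.neg_re] at h
  simp only [Matrix.neg_apply, norm_neg] at h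
  unfold reRayleigh
  linarith

/-- The bottom is a lower bound: `-Σᵢⱼ ‖A i j‖ ≤ q(v)` on unit vectors. [folklore] -/
theorem neg_entry_sum_le_reRayleigh (A : Matrix m m ℂ) {v : m → ℂ} (hv : star v ⬝ᵥ v = 1) :
    -(∑ i, ∑ j, ‖A i j‖) ≤ reRayleigh A v :=
  (abs_le.1 (abs_reRayleigh_le A hv)).1

/-- The `dotProduct`-unit set of `m → ℂ` is compact. [folklore] -/
theorem isCompact_unitSet : IsCompact {v : m → ℂ | star v ⬝ᵥ v = 1} := by
  refine Metric.isCompact_of_isClosed_isBounded ?_ ?_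
  · exact isClosed_eq (continuous_id.star.dotProduct continuous_id) continuous_const
  · refine (Metric.isBounded_closedBall (x := (0 : m → ℂ)) (r := 1)).subset fun v hv => ?_
    rw [Metric.mem_closedBall, dist_zero_right, pi_norm_le_iff_of_nonneg zero_le_one]
    exact Matrix.norm_apply_le_one_of_star_dotProduct_self_eq_one hv

/-- The Rayleigh quotient is continuous. [folklore] -/
theorem continuous_reRayleigh (A : Matrix m m ℂ) : Continuous (reRayleigh A) := by
  unfold reRayleigh
  exact Complex.continuous_re.comp
    (continuous_id.star.dotProduct (continuous_const.matrix_mulVec continuous_id))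

/-- **The bottom is attained** on the (compact, nonempty) unit set. [folklore] -/
theorem exists_min_reRayleigh [Nonempty m] (A : Matrix m m ℂ) :
    ∃ f : m → ℂ, star f ⬝ᵥ f = 1 ∧ ∀ v : m → ℂ, star v ⬝ᵥ v = 1 → reRayleigh A f ≤ reRayleigh A v := by
  classical
  have hne : ({v : m → ℂ | star v ⬝ᵥ v = 1} : Set (m → ℂ)).Nonempty := by
    refine ⟨Pi.single (Classical.arbitrary m) 1, ?_⟩
    show star (Pi.single (Classical.arbitrary m) (1 : ℂ)) ⬝ᵥ Pi.single (Classical.arbitrary m) 1 = 1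
    rw [dotProduct_single]
    simp
  obtain ⟨f, hf, hmin⟩ := isCompact_unitSet.exists_isMinOn hne (continuous_reRayleigh A).continuousOn
  exact ⟨f, hf, fun v hv => isMinOn_iff.1 hmin v hv⟩

/-- `-(-A).supRayleigh ≤ q(v)` for every unit `v` (the tree's `Matrix.rayleigh_le_supRayleigh_holds`
for `-A`). [folklore] -/
theorem neg_supRayleigh_neg_le (A : Matrix m m ℂ) {v : m → ℂ} (hv : star v ⬝ᵥ v = 1) :
    -(-A).supRayleigh ≤ reRayleigh A v := by
  have key := Matrix.rayleigh_le_supRayleigh_holds (-A) v hv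
  rw [Matrix.neg_mulVec, dotProduct_neg, Complex.neg_re] at key
  unfold reRayleigh
  linarith

/-- A global minimiser of `q` on the unit set has `q(f) = -(-A).supRayleigh`. [folklore] -/
theorem reRayleigh_eq_of_min (A : Matrix m m ℂ) {f : m → ℂ} (hf : star f ⬝ᵥ f = 1)
    (hmin : ∀ v, star v ⬝ᵥ v = 1 → reRayleigh A f ≤ reRayleigh A v) :
    reRayleigh A f = -(-A).supRayleigh := by
  refine le_antisymm ?_ (neg_supRayleigh_neg_le A hf)
  have : (-A).supRayleigh ≤ -reRayleigh A f := by
    haveI : Nonempty {w : m → ℂ // star w ⬝ᵥ w = 1} := ⟨⟨f, hf⟩⟩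
    refine ciSup_le fun w => ?_
    rw [Matrix.neg_mulVec, dotProduct_neg, Complex.neg_re]
    exact neg_le_neg (hmin w.1 w.2)
  linarith

/-- Homogeneous form of the bottom: `-(-A).supRayleigh · ‖v‖² ≤ q(v)` for every `v`. [folklore] -/
theorem bottom_mul_le_reRayleigh (A : Matrix m m ℂ) (v : m → ℂ) :
    -(-A).supRayleigh * (star v ⬝ᵥ v).re ≤ reRayleigh A v := by
  by_cases hv : v = 0
  · subst hv
    simp [reRayleigh]
  have hpos := re_star_dotProduct_self_pos hv
  obtain ⟨c, hc1, hc2⟩ := exists_smul_unit hpos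
  have h := neg_supRayleigh_neg_le A hc1
  rw [reRayleigh_smul] at h
  calc -(-A).supRayleigh * (star v ⬝ᵥ v).re
      ≤ ‖c‖ ^ 2 * reRayleigh A v * (star v ⬝ᵥ v).re := mul_le_mul_of_nonneg_right h hpos.le
    _ = ‖c‖ ^ 2 * (star v ⬝ᵥ v).re * reRayleigh A v := by ring
    _ = reRayleigh A v := by rw [hc2, one_mul]

/-- If `0 ≤ a t + b t²` for all real `t` then `a = 0`. [folklore] -/
theorem eq_zero_of_forall_quad_nonneg {a b : ℝ} (h : ∀ t : ℝ, 0 ≤ a * t + b * t ^ 2) : a = 0 := by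
  by_contra ha
  have hb : 0 < |b| + 1 := by positivity
  have h1 := h (-a / (|b| + 1))
  have key : a * (-a / (|b| + 1)) + b * (-a / (|b| + 1)) ^ 2 =
      a ^ 2 * ((b - |b| - 1) / (|b| + 1) ^ 2) := by
    field_simp
    ring
  rw [key] at h1
  have hneg : (b - |b| - 1) / (|b| + 1) ^ 2 < 0 :=
    div_neg_of_neg_of_pos (by linarith [le_abs_self b]) (by positivity)
  have ha2 : 0 < a ^ 2 := by positivity
  nlinarith

/-- Expansion of `q(f + t g)` for real `t`. [folklore] -/
theorem reRayleigh_add_real_smul (A : Matrix m m ℂ) (f g : m → ℂ) (t : ℝ) :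
    reRayleigh A (f + (t : ℂ) • g) = reRayleigh A f +
      t * (star f ⬝ᵥ (A *ᵥ g) + star g ⬝ᵥ (A *ᵥ f)).re + t ^ 2 * reRayleigh A g := by
  have h := star_lincomb_dotProduct_mulVec A 1 (t : ℂ) f g
  rw [one_smul] at h
  rw [reRayleigh, reRayleigh, reRayleigh, h]
  simp only [star_one, one_mul, mul_one, Complex.star_def, Complex.conj_ofReal, Complex.add_re,
    Complex.re_ofReal_mul, ← mul_add]
  rw [← Complex.ofReal_mul, Complex.re_ofReal_mul]
  ring

/-- Expansion of `‖f + t g‖²` for real `t`. [folklore] -/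
theorem re_star_dotProduct_add_real_smul (f g : m → ℂ) (t : ℝ) :
    (star (f + (t : ℂ) • g) ⬝ᵥ (f + (t : ℂ) • g)).re = (star f ⬝ᵥ f).re +
      t * (star f ⬝ᵥ g + star g ⬝ᵥ f).re + t ^ 2 * (star g ⬝ᵥ g).re := by
  have h := star_lincomb_dotProduct 1 (t : ℂ) f g
  rw [one_smul] at h
  rw [h]
  simp only [star_one, one_mul, mul_one, Complex.star_def, Complex.conj_ofReal, Complex.add_re,
    Complex.re_ofReal_mul, ← mul_add]
  rw [← Complex.ofReal_mul, Complex.re_ofReal_mul]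
  ring

/-- **First variation at a global minimiser**: for `g ⊥ f`, `⟨f, A g⟩ + conj ⟨g, A f⟩ = 0`
(the minimiser is an eigenvector of the Hermitian part). [folklore] -/
theorem cross_eq_zero_of_min (A : Matrix m m ℂ) {f : m → ℂ} (hf : star f ⬝ᵥ f = 1)
    (hmin : ∀ v, star v ⬝ᵥ v = 1 → reRayleigh A f ≤ reRayleigh A v) {g : m → ℂ}
    (hg : star f ⬝ᵥ g = 0) :
    star f ⬝ᵥ (A *ᵥ g) + star (star g ⬝ᵥ (A *ᵥ f)) = 0 := by
  have hfq : reRayleigh A f = -(-A).supRayleigh := reRayleigh_eq_of_min A hf hmin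
  have hf1 : (star f ⬝ᵥ f).re = 1 := by rw [hf, Complex.one_re]
  have key : ∀ g' : m → ℂ, star f ⬝ᵥ g' = 0 →
      (star f ⬝ᵥ (A *ᵥ g') + star g' ⬝ᵥ (A *ᵥ f)).re = 0 := by
    intro g' hg'
    have hg'f : star g' ⬝ᵥ f = 0 := by rw [star_dotProduct, hg', star_zero]
    refine eq_zero_of_forall_quad_nonneg
      (b := reRayleigh A g' - -(-A).supRayleigh * (star g' ⬝ᵥ g').re) fun t => ?_
    have h := bottom_mul_le_reRayleigh A (f + (t : ℂ) • g')
    rw [reRayleigh_add_real_smul, re_star_dotProduct_add_real_smul, hg', hg'f, add_zero,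
      Complex.zero_re, mul_zero, add_zero, hf1, hfq] at h
    nlinarith [h]
  have h1 := key g hg
  have h2 := key (Complex.I • g) (by rw [dotProduct_smul, hg, smul_zero])
  rw [Matrix.mulVec_smul, dotProduct_smul, star_smul, smul_dotProduct, smul_eq_mul, smul_eq_mul,
    Complex.star_def, Complex.conj_I] at h2
  simp only [Complex.add_re, Complex.mul_re, Complex.I_re, Complex.I_im, Complex.neg_re,
    zero_mul, one_mul, zero_sub, neg_mul, neg_neg] at h2
  simp only [Complex.add_re] at h1
  apply Complex.ext
  · simp only [Complex.add_re, Complex.star_def, Complex.conj_re, Complex.zero_re]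
    linarith
  · simp only [Complex.add_im, Complex.star_def, Complex.conj_im, Complex.zero_im]
    linarith

/-- **Two-dimensional step**: for orthogonal unit vectors `f, g` with vanishing first variation and
`q(f) ≤ q(g)`, every hyperplane `f'ᗮ` contains a unit vector of the plane `span{f, g}` with Rayleigh
quotient `≤ q(g)`. [folklore] -/
theorem exists_unit_orth_le (A : Matrix m m ℂ) {f g : m → ℂ} (hf : star f ⬝ᵥ f = 1)
    (hg : star g ⬝ᵥ g = 1) (hfg : star f ⬝ᵥ g = 0)
    (hcross : star f ⬝ᵥ (A *ᵥ g) + star (star g ⬝ᵥ (A *ᵥ f)) = 0)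
    (hle : reRayleigh A f ≤ reRayleigh A g) (f' : m → ℂ) :
    ∃ u : m → ℂ, star u ⬝ᵥ u = 1 ∧ star f' ⬝ᵥ u = 0 ∧ reRayleigh A u ≤ reRayleigh A g := by
  set a := star f' ⬝ᵥ f with ha_def
  set b := star f' ⬝ᵥ g with hb_def
  by_cases ha : a = 0
  · exact ⟨f, hf, ha, hle⟩
  have hgf : star g ⬝ᵥ f = 0 := by rw [star_dotProduct, hfg, star_zero]
  have hy : star g ⬝ᵥ (A *ᵥ f) = -star (star f ⬝ᵥ (A *ᵥ g)) := by
    have := congrArg star hcross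
    rw [star_add, star_star, star_zero] at this
    linear_combination this
  set u₀ := b • f + (-a) • g with hu₀_def
  -- norm and Rayleigh quotient of `u₀`
  have hN : (star u₀ ⬝ᵥ u₀).re = ‖b‖ ^ 2 + ‖a‖ ^ 2 := by
    rw [hu₀_def, star_lincomb_dotProduct, hf, hg, hfg, hgf]
    simp only [mul_one, mul_zero, add_zero, Complex.add_re]
    rw [← mul_one (star b * b), ← mul_one (star (-a) * -a), re_star_mul_self_mul, re_star_mul_self_mul,
      norm_neg, Complex.one_re, mul_one, mul_one]
  have hQ : reRayleigh A u₀ = ‖b‖ ^ 2 * reRayleigh A f + ‖a‖ ^ 2 * reRayleigh A g := by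
    rw [reRayleigh, hu₀_def, star_lincomb_dotProduct_mulVec, hy]
    simp only [Complex.add_re, re_star_mul_self_mul, norm_neg]
    have : (star b * -a * (star f ⬝ᵥ (A *ᵥ g))).re +
        (star (-a) * b * -star (star f ⬝ᵥ (A *ᵥ g))).re = 0 := by
      have hconj : star (-a) * b * -star (star f ⬝ᵥ (A *ᵥ g)) =
          -star (star b * -a * (star f ⬝ᵥ (A *ᵥ g))) := by
        simp only [star_mul, star_neg, star_star]
        ring
      rw [hconj, Complex.neg_re, Complex.star_def, Complex.conj_re]
      ring
    rw [this, add_zero]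
    rfl
  have hpos : 0 < (star u₀ ⬝ᵥ u₀).re := by
    rw [hN]
    have : 0 < ‖a‖ := norm_pos_iff.2 ha
    positivity
  obtain ⟨c, hc1, hc2⟩ := exists_smul_unit hpos
  refine ⟨c • u₀, hc1, ?_, ?_⟩
  · rw [dotProduct_smul, hu₀_def, dotProduct_add, dotProduct_smul, dotProduct_smul, ← ha_def, ← hb_def,
      smul_eq_mul, smul_eq_mul, smul_eq_mul]
    ring
  · rw [reRayleigh_smul, hQ]
    rw [hN] at hc2
    have hb2 : 0 ≤ ‖c‖ ^ 2 * ‖b‖ ^ 2 := by positivity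
    calc ‖c‖ ^ 2 * (‖b‖ ^ 2 * reRayleigh A f + ‖a‖ ^ 2 * reRayleigh A g)
        ≤ ‖c‖ ^ 2 * (‖b‖ ^ 2 * reRayleigh A g + ‖a‖ ^ 2 * reRayleigh A g) := by nlinarith
      _ = ‖c‖ ^ 2 * (‖b‖ ^ 2 + ‖a‖ ^ 2) * reRayleigh A g := by ring
      _ = reRayleigh A g := by rw [hc2, one_mul]

/-- `⟨u, A v⟩ = ⟨Aᴴ u, v⟩`. [folklore] -/
theorem star_dotProduct_mulVec_eq (A : Matrix m m ℂ) (u v : m → ℂ) :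
    star u ⬝ᵥ (A *ᵥ v) = star (Aᴴ *ᵥ u) ⬝ᵥ v := by
  rw [Matrix.star_mulVec, Matrix.conjTranspose_conjTranspose, Matrix.dotProduct_mulVec]

end Rayleigh

end RayleighBottom

end Literature.MathematicalPhysics.QuantumLattice

end
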